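import Literature.IUT.LogThetaLattice.GlobalFrobenioidModelsTransport
import Literature.IUT.LogThetaLattice.GlobalFrobenioidModelsLogVolume
import Literature.NumberTheory.NumberFields.PlacesOfRingEquivNorms
import HarnessLib

/-!
# [IUTchIII] Prop. 3.10 (iii), realified clause / Prop. 3.9 (iii) at the model: the Kummer transport of the
# model global Frobenioid preserves arithmetic degrees and global log-volumes (proof-only companion)

Proof-only sequel (abc-iut cell, D-0067 wave 4, seat abc-iut-w4-d002) of `GlobalFrobenioidModelsTransport.lean`
(the functorial algorithm `frakTransport σ` along an isomorphism of number fields `σ : K ≃+* K'`) over the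
model degree / log-volume file `GlobalFrobenioidModelsLogVolume.lean` (`frakDivisor`, `frakDeg`,
`frakRegion`, `globalLogVolume_frakRegion`). S. Mochizuki, *Inter-universal Teichmüller theory III*, kurims
manuscript (May 2020), Prop. 3.10 (iii) p. 149: the Kummer isomorphisms induce isomorphisms of the REALIFIED
Frobenioids `(^{n,m}𝓕⊛ℝ_MOD)_α ⥲ 𝓕⊛ℝ_MOD(^{n,∘}𝓗𝓣^𝒟)_α` "mutually compatible … with the log-links"; Prop. 3.9
(iii) p. 117: the global log-volume "is equal to the degree of the arithmetic line bundle determined by `𝔍`"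
and the log-volumes are compatible with the isomorphisms in play (claim key Mochizuki2012, DISPUTED, D-0012).

PROVED HERE (classical inputs: `PlacesOfRingEquivNorms` — `N(σ𝔭) = N(𝔭)`, `[K'_{σw} : ℝ] = [K_w : ℝ]`):
* `logNorm_finitePlaceEquiv`, `mult_infinitePlaceEquiv` — the degree weights `log q_v`, `[K_v : ℝ]` of the
  places are preserved under `placesEquiv σ`;
* `frakTransport_smul` — the transport is equivariant for `𝔍 ↦ f·𝔍` (`σ_*(f·𝔍) = (σ f)·σ_*𝔍`; the "monoids"
  clause of the Kummer compatibility of Prop. 3.10 (i));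
* `frakDivisor_frakTransport` — the arithmetic divisor of the transported object is the transported divisor;
* **`frakDeg_frakTransport`** — `deg(σ_* 𝔍) = deg(𝔍)`: the Kummer transport preserves the arithmetic
  degree — the invariant through which the REALIFIED Frobenioids `𝓕⊛ℝ_MOD` enter [IUTchIII] §3 (Prop. 3.9
  (iii): global log-volume = degree) — so the compatible family of `prop310iii_model` is compatible with
  degrees / log-volumes; this is the degree-level content of the `𝓕⊛ℝ_MOD` clause of Prop. 3.10 (iii) at
  the model (the isomorphism of realified CATEGORIES is not constructed here);
* **`globalLogVolume_frakRegion_frakTransport`** — `μ^log(σ_* 𝔍) = μ^log(𝔍)` (Prop. 3.9 (iii) degree clause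
  transported);
* `prop310iii_model_deg` — along the compatible family of `prop310iii_model` the degree is constant:
  `deg(lg_m 𝔍) = deg 𝔍` and `deg(kum_m 𝔍) = deg 𝔍`.
(The instantiation of the OUTPUT SIGNATURE of Prop. 3.10 (i) by these real Kummer data is the `def`
`VerticallyCoricGlobalData.ofKummerColumn` of the companion `GlobalFrobenioidModelsTransportTorsor.lean`.)
Nothing here takes a side on [IUTchIII] Cor. 3.12; typed ≠ discharged elsewhere.
-/

noncomputable section

namespace Literature.IUT.LogThetaLattice

namespace GlobalFrobenioidModels

open NumberField IsDedekindDomain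
open Literature.NumberTheory.NumberFields Literature.IUT.LogVolume

universe u

variable {K K' : Type u} [Field K] [NumberField K] [Field K'] [NumberField K']

/-- The degree weight `log q_v` of a finite place is preserved under `σ : K ≃+* K'` (`N(σ𝔭) = N(𝔭)`).
([IUTchIII] Prop 3.9 (iii) p.117) [claim: Mochizuki2012, status: disputed] -/
theorem logNorm_finitePlaceEquiv (σ : K ≃+* K') (w : HeightOneSpectrum (𝓞 K)) :
    logNorm K' (finitePlaceEquiv σ w) = logNorm K w := by
  rw [logNorm, logNorm, finitePlaceEquiv_asIdeal, absNorm_map_mapRingEquiv]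

omit [NumberField K] [NumberField K'] in
/-- The weight `[K_v : ℝ]` of an archimedean place is preserved under `σ : K ≃+* K'`.
([IUTchIII] Prop 3.9 (iii) p.117) [claim: Mochizuki2012, status: disputed] -/
theorem mult_infinitePlaceEquiv (σ : K ≃+* K') (w : InfinitePlace K) :
    (infinitePlaceEquiv σ w).mult = w.mult :=
  mult_comap_symm σ w

omit [NumberField K] [NumberField K'] in
/-- `placeMult` (the divisor-coordinate weight `[K_v:ℝ]` resp. `1`) is preserved under the transport of
places (read on the divisor-side index `𝕍^arc ⊔ 𝕍^non` through `Sum.swap`).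
([IUTchIII] Ex 3.6 (ii) p.107) [claim: Mochizuki2012, status: disputed] -/
theorem placeMult_placesEquiv_swap (σ : K ≃+* K') (p : Place K) :
    placeMult ((placesEquiv σ p.swap).swap : Place K') = placeMult p := by
  rcases p with v | w
  · simp [mult_infinitePlaceEquiv]
  · simp

/-- The degree weight `degWeight` (`1` resp. `log q_v`) is preserved under the transport of places.
([IUTchIII] Prop 3.9 (iii) p.117) [claim: Mochizuki2012, status: disputed] -/
theorem degWeight_placesEquiv_swap (σ : K ≃+* K') (p : Place K) :
    degWeight K' ((placesEquiv σ p.swap).swap : Place K') = degWeight K p := by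
  rcases p with v | w
  · simp
  · simp [logNorm_finitePlaceEquiv]

/-- **The Kummer transport is equivariant for the action `𝔍 ↦ f·𝔍` of the multiplicative group** ([IUTchIII]
Ex. 3.6 (ii) "for any element `f ∈ F^×_mod`, one obtains an object `f·𝔍`"; Prop. 3.10 (i): the Kummer
isomorphisms of "fields, monoids, Frobenioids" are "compatible with the various … natural
isomorphisms"): `σ_*(f·𝔍) = (σ f)·(σ_* 𝔍)`. ([IUTchIII] Prop 3.10 (i) p.148) [claim: Mochizuki2012, status: disputed] -/
theorem frakTransport_smul (σ : K ≃+* K') (f : Kˣ)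
    (hf : {v : ModelPlaces K | betaModel v (Additive.ofMul f) ≠ 0}.Finite) (J : ModelFrakObj K) :
    frakTransport σ (FrakObj.smul (β := betaModel) f hf J) =
      FrakObj.smul (β := betaModel) (Units.map (σ : K →* K') f)
        (finite_betaModel_ne_zero (Units.map (σ : K →* K') f)) (frakTransport σ J) := by
  refine FrakObj.ext_cls (funext fun v' => ?_)
  obtain ⟨v, rfl⟩ := (placesEquiv σ).surjective v'
  change betaModel ((placesEquiv σ).symm (placesEquiv σ v)) (Additive.ofMul f) +
      J.cls ((placesEquiv σ).symm (placesEquiv σ v)) =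
    betaModel (placesEquiv σ v) (Additive.ofMul (Units.map (σ : K →* K') f)) +
      J.cls ((placesEquiv σ).symm (placesEquiv σ v))
  rw [Equiv.symm_apply_apply, betaModel_placesEquiv]

/-- **The arithmetic divisor of the transported object is the transported divisor**:
`frakDivisor (σ_* 𝔍) = (frakDivisor 𝔍)` re-indexed along the correspondence of places.
([IUTchIII] Ex 3.6 (ii) p.108; Prop 3.10 (iii) p.149) [claim: Mochizuki2012, status: disputed] -/
theorem frakDivisor_frakTransport (σ : K ≃+* K') (J : ModelFrakObj K) :
    frakDivisor (frakTransport σ J) =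
      Finsupp.equivMapDomain
        ((Equiv.sumComm _ _).trans ((placesEquiv σ).trans (Equiv.sumComm _ _))) (frakDivisor J) := by
  ext p'
  rw [Finsupp.equivMapDomain_apply, frakDivisor_apply, frakDivisor_apply]
  obtain ⟨p, rfl⟩ := ((Equiv.sumComm _ _).trans ((placesEquiv σ).trans (Equiv.sumComm _ _))).surjective p'
  rw [Equiv.symm_apply_apply]
  change -(placeMult ((placesEquiv σ p.swap).swap : Place K') *
      J.cls ((placesEquiv σ).symm ((placesEquiv σ p.swap).swap.swap))) = -(placeMult p * J.cls p.swap)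
  rw [Sum.swap_swap, Equiv.symm_apply_apply, placeMult_placesEquiv_swap]

/-- **`deg(σ_* 𝔍) = deg(𝔍)`** — the Kummer transport of the model global Frobenioid preserves the arithmetic
degree (the degree-level content of the `𝓕⊛ℝ_MOD` (realified) clause of [IUTchIII] Prop. 3.10 (iii) at the
model; the realified category itself is not constructed here). ([IUTchIII] Prop 3.10 (iii) p.149)
[claim: Mochizuki2012, status: disputed] -/
theorem frakDeg_frakTransport (σ : K ≃+* K') (J : ModelFrakObj K) :
    frakDeg (frakTransport σ J) = frakDeg J := by
  rw [frakDeg, frakDeg, frakDivisor_frakTransport, degF, degF, Finsupp.linearCombination_equivMapDomain]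
  congr 2
  funext p
  exact degWeight_placesEquiv_swap σ p

/-- **`μ^log(σ_* 𝔍) = μ^log(𝔍)`** — the global log-volume of the region of an object of the model global
Frobenioid is preserved by the Kummer transport ([IUTchIII] Prop. 3.9 (iii) "equal to the degree …",
transported). ([IUTchIII] Prop 3.9 (iii) p.117) [claim: Mochizuki2012, status: disputed] -/
theorem globalLogVolume_frakRegion_frakTransport (σ : K ≃+* K') (J : ModelFrakObj K) :
    globalLogVolume (divisorLogVolume K') (frakRegion (frakTransport σ J)) =
      globalLogVolume (divisorLogVolume K) (frakRegion J) := by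
  rw [globalLogVolume_frakRegion, globalLogVolume_frakRegion, frakDeg_frakTransport]

/-- Along the compatible family of `prop310iii_model` (Prop. 3.10 (iii) at the model) the degree is
CONSTANT: both the Kummer bijections `σ_*` with `σ = κ_m` and the log-link-induced maps (`σ = κ_{m+1}⁻¹ ∘ κ_m`)
preserve `deg` (compatibility of the family with degrees / global log-volumes).
([IUTchIII] Prop 3.10 (iii) p.149) [claim: Mochizuki2012, status: disputed] -/
theorem prop310iii_model_deg {Kf : ℤ → Type u} [∀ m, Field (Kf m)] [∀ m, NumberField (Kf m)]
    {Kc : Type u} [Field Kc] [NumberField Kc] (κ : ∀ m, Kf m ≃+* Kc) (m : ℤ) (J : ModelFrakObj (Kf m)) :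
    frakDeg (frakTransport (κ m) J) = frakDeg J ∧
      frakDeg (frakTransport ((κ m).trans (κ (m + 1)).symm) J) = frakDeg J :=
  ⟨frakDeg_frakTransport (κ m) J, frakDeg_frakTransport _ J⟩

end GlobalFrobenioidModels

end Literature.IUT.LogThetaLattice
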